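import Mathlib
import Summits.AtomisticToContinuum.HydrodynamicLimit.Theorems.ImplosionDichotomyDenseExcursionSonicRealBoundUnique

/-!
# The mode system at the centre in the variables of the acoustic standing wave
# (crux `DenseExcursion`, line `sonic-cavity-renewal`, brick for `centreContent_of_tube`)

Helper file (`--supports stmt-AtomisticToContinuum-12586`, line lead a2, stub-worker W3 for `centreContent_of_tube`).

Near the centre `x → −∞` (`ρ = eˣ → 0`) the bounded quantities of a centre-regular pair are `𝒰 = eˣ ŵ`, `𝒮 = eˣ ŝ`
(`…R2Modes.IsRegularPair`). Solving the mode equations `Λŵ = linW`, `Λŝ = linS` for the derivatives (`mode_cramer`,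
`…SonicRealBoundUnique`) and writing `d = (W − 1)² − S²`, the pair satisfies EXACTLY
  `𝒰′ = (Λθ − 2 + A)𝒰 + (3Λk + B)𝒮`, `𝒮′ = (Λθ + D)𝒮 + (Λk/3 + C)𝒰`,
with the real coefficients `θ = (W−1)/d`, `k = −S/d` and `A, B, C, D` defined by
`(A − 3)d = −(W−1)(W′+2W−r) + 3S(S′+2S)`, `Bd = −(W−1)(3S′+6S) + 3S(W′/3+2W−r)`, `Cd = −(W−1)(S′+2S) + (S/3)(W′+2W−r)`,
`(D − 1)d = −(W−1)(W′/3+2W−r) + (S/3)(3S′+6S)` (`inner_UcSc_hasDerivAt`, registered helper). At the centre `Λk ≈ Λeˣ/s₀`,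
`θ, A, D = O(e^{2x})`, `B = O(e^{3x})`, `C ≈ −(2(2−r)/3)k`, and the term `Λθ` is COMMON to both components (the advection
`(W − 1)∂ₓ` acts diagonally), so it drops out of every quadratic quantity below. In the travelling-wave amplitudes
`v = 𝒮 + (Λk/3)𝒰`, `z = Λk𝒮` the system becomes the symmetric pair `v′ = Θv + κz + E_v`, `z′ = Θz + κv + E_z` (`κ = Λk`,
`inner_vz_hasDerivAt`), whose model (`E = 0`) has `|v + z|`, `|v − z|` (∝ the two characteristic amplitudes `ρ²|ŵ ± 3ŝ|`)
growing at the rates `Re(Θ ± κ)`: the acoustic standing wave `𝒮 ∝ sinh(Λρ/s₀)/ρ`. The pure algebra of the derivatives of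
`‖v ± z‖²`, `‖v‖² + ‖z‖²`, `‖𝒰‖²/9 + ‖𝒮‖²` is recorded as `dEp_alg`, `dEm_alg`, `dE_alg`, `dN_alg`.

Sources: Olver 1974 Ch. 12 (LG near a simple pole); Coddington–Levinson Ch. 4. NOT here: any estimate (see the companion
files `…SonicCentreContentInner*`).
-/

noncomputable section

open Set

namespace Summit.AtomisticToContinuum.HydrodynamicLimit.Theorems.SonicCavityRenewal

open Summit.AtomisticToContinuum.HydrodynamicLimit.Theorems.R2OneModeTwoConditions

/-! ## Calculus of quadratic quantities of complex curves -/

/-- `d/dx ‖f‖² = 2 Re(conj f · f′)` for a differentiable curve `f : ℝ → ℂ`. [folklore] -/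
theorem hasDerivAt_norm_sq_complex {f : ℝ → ℂ} {f' : ℂ} {x : ℝ} (h : HasDerivAt f f' x) :
    HasDerivAt (fun y => ‖f y‖ ^ 2) (2 * (starRingEnd ℂ (f x) * f').re) x := by
  have h1 : HasDerivAt (fun y => (f y).re) f'.re x := by
    simpa [Function.comp_def] using Complex.reCLM.hasFDerivAt.comp_hasDerivAt x h
  have h2 : HasDerivAt (fun y => (f y).im) f'.im x := by
    simpa [Function.comp_def] using Complex.imCLM.hasFDerivAt.comp_hasDerivAt x h
  have h3 := (h1.mul h1).add (h2.mul h2)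
  have e : (fun y => ‖f y‖ ^ 2) = fun y => (f y).re * (f y).re + (f y).im * (f y).im := by
    funext y
    rw [Complex.sq_norm, Complex.normSq_apply]
  rw [e]
  refine h3.congr_deriv ?_
  simp only [Complex.mul_re, Complex.conj_re, Complex.conj_im]
  ring

/-! ## Pure algebra: derivatives of the quadratic quantities along the symmetric pair system -/

/-- Along `v′ = Θv + κz + E_v`, `z′ = Θz + κv + E_z`: `(‖v+z‖²)′ = 2Re(Θ+κ)‖v+z‖² + 2Re(conj(v+z)(E_v+E_z))`. [folklore] -/
theorem dEp_alg (v z Dv Dz Θ κ Ev Ez : ℂ) (hv : Dv = Θ * v + κ * z + Ev) (hz : Dz = Θ * z + κ * v + Ez) :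
    2 * (starRingEnd ℂ (v + z) * (Dv + Dz)).re =
      2 * (Θ + κ).re * ‖v + z‖ ^ 2 + 2 * (starRingEnd ℂ (v + z) * (Ev + Ez)).re := by
  subst hv hz
  simp only [Complex.mul_re, Complex.mul_im, Complex.add_re, Complex.add_im, Complex.conj_re, Complex.conj_im,
    Complex.sq_norm, Complex.normSq_apply, map_add]
  ring

/-- Along the same system: `(‖v−z‖²)′ = 2Re(Θ−κ)‖v−z‖² + 2Re(conj(v−z)(E_v−E_z))`. [folklore] -/
theorem dEm_alg (v z Dv Dz Θ κ Ev Ez : ℂ) (hv : Dv = Θ * v + κ * z + Ev) (hz : Dz = Θ * z + κ * v + Ez) :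
    2 * (starRingEnd ℂ (v - z) * (Dv - Dz)).re =
      2 * (Θ - κ).re * ‖v - z‖ ^ 2 + 2 * (starRingEnd ℂ (v - z) * (Ev - Ez)).re := by
  subst hv hz
  simp only [Complex.mul_re, Complex.mul_im, Complex.add_re, Complex.add_im, Complex.sub_re, Complex.sub_im,
    Complex.conj_re, Complex.conj_im, Complex.sq_norm, Complex.normSq_apply, map_sub]
  ring

/-- Along the same system: `(‖v‖² + ‖z‖²)′ = 2ReΘ(‖v‖²+‖z‖²) + 4Reκ·Re(conj v·z) + 2Re(conj v·E_v) + 2Re(conj z·E_z)`.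
[folklore] -/
theorem dE_alg (v z Dv Dz Θ κ Ev Ez : ℂ) (hv : Dv = Θ * v + κ * z + Ev) (hz : Dz = Θ * z + κ * v + Ez) :
    2 * (starRingEnd ℂ v * Dv).re + 2 * (starRingEnd ℂ z * Dz).re =
      2 * Θ.re * (‖v‖ ^ 2 + ‖z‖ ^ 2) + 4 * κ.re * (starRingEnd ℂ v * z).re +
        2 * (starRingEnd ℂ v * Ev).re + 2 * (starRingEnd ℂ z * Ez).re := by
  subst hv hz
  simp only [Complex.mul_re, Complex.mul_im, Complex.add_re, Complex.add_im, Complex.conj_re, Complex.conj_im,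
    Complex.sq_norm, Complex.normSq_apply]
  ring

/-- Along `𝒰′ = (Θ−2+A)𝒰 + (3κ+B)𝒮`, `𝒮′ = (Θ+D)𝒮 + (κ/3+C)𝒰` (`A, B, C, D` real):
`(‖𝒰‖²/9 + ‖𝒮‖²)′ = 2ReΘ(‖𝒰‖²/9+‖𝒮‖²) − (4/9)‖𝒰‖² + (2A/9)‖𝒰‖² + 2D‖𝒮‖² + ((4/3)Reκ + 2B/9 + 2C)Re(conj 𝒰·𝒮)` — the
`κ`-coupling contributes only through `Re κ` with these weights. [folklore] -/
theorem dN_alg (U S DU DS Θ κ : ℂ) (A B C D : ℝ) (hU : DU = (Θ - 2 + A) * U + (3 * κ + B) * S)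
    (hS : DS = (Θ + D) * S + (κ / 3 + C) * U) :
    2 / 9 * (starRingEnd ℂ U * DU).re + 2 * (starRingEnd ℂ S * DS).re =
      2 * Θ.re * (‖U‖ ^ 2 / 9 + ‖S‖ ^ 2) - 4 / 9 * ‖U‖ ^ 2 + 2 * A / 9 * ‖U‖ ^ 2 + 2 * D * ‖S‖ ^ 2 +
        (4 / 3 * κ.re + 2 * B / 9 + 2 * C) * (starRingEnd ℂ U * S).re := by
  subst hU hS
  simp only [Complex.mul_re, Complex.mul_im, Complex.add_re, Complex.add_im, Complex.sub_re, Complex.sub_im,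
    Complex.conj_re, Complex.conj_im, Complex.sq_norm, Complex.normSq_apply, Complex.ofReal_re, Complex.ofReal_im,
    Complex.div_ofNat_re, Complex.div_ofNat_im, Complex.re_ofNat, Complex.im_ofNat]
  ring

/-! ## The mode system in the centre variables -/

/-- **THE MODE SYSTEM IN THE CENTRE VARIABLES** — registered helper `inner_UcSc_hasDerivAt` for `centreContent_of_tube`.
For a solution of the mode equations at `x` with `d = (W−1)² − S² ≠ 0`, the bounded centre variables `𝒰 = eˣŵ`, `𝒮 = eˣŝ`
satisfy `𝒰′ = (Λθ − 2 + A)𝒰 + (3Λk + B)𝒮`, `𝒮′ = (Λθ + D)𝒮 + (Λk/3 + C)𝒰` for any reals `θ, k, A, B, C, D` solving the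
defining equations of the file header (Cramer, `mode_cramer`, plus the product rule). [folklore] -/
theorem inner_UcSc_hasDerivAt : ∀ {r : ℝ} {W S : ℝ → ℝ} {Λ : ℂ} {ŵ ŝ : ℝ → ℂ} {x : ℝ}, DifferentiableAt ℝ ŵ x → DifferentiableAt ℝ ŝ x → Λ * ŵ x = linW r W S ŵ ŝ x → Λ * ŝ x = linS r W S ŵ ŝ x → ∀ {θr kr A Bc Cc Dc : ℝ}, (W x - 1) ^ 2 - S x ^ 2 ≠ 0 → θr * ((W x - 1) ^ 2 - S x ^ 2) = W x - 1 → kr * ((W x - 1) ^ 2 - S x ^ 2) = -S x → (A - 3) * ((W x - 1) ^ 2 - S x ^ 2) = -(W x - 1) * (deriv W x + 2 * W x - r) + 3 * S x * (deriv S x + 2 * S x) → Bc * ((W x - 1) ^ 2 - S x ^ 2) = -(W x - 1) * (3 * deriv S x + 6 * S x) + 3 * S x * (deriv W x / 3 + 2 * W x - r) → Cc * ((W x - 1) ^ 2 - S x ^ 2) = -(W x - 1) * (deriv S x + 2 * S x) + S x / 3 * (deriv W x + 2 * W x - r) → (Dc - 1) * ((W x - 1) ^ 2 - S x ^ 2)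 = -(W x - 1) * (deriv W x / 3 + 2 * W x - r) + S x / 3 * (3 * deriv S x + 6 * S x) → HasDerivAt (fun y => (Real.exp y : ℂ) * ŵ y) ((Λ * θr - 2 + A) * ((Real.exp x : ℂ) * ŵ x) + (3 * (Λ * kr) + Bc) * ((Real.exp x : ℂ) * ŝ x)) x ∧ HasDerivAt (fun y => (Real.exp y : ℂ) * ŝ y) ((Λ * θr + Dc) * ((Real.exp x : ℂ) * ŝ x) + (Λ * kr / 3 + Cc) * ((Real.exp x : ℂ) * ŵ x)) x := by
  intro r W S Λ ŵ ŝ x hŵ hŝ h₁ h₂ θr kr A Bc Cc Dc hd0 hθ hk hA hB hC hD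
  obtain ⟨e₁, e₂⟩ := mode_cramer h₁ h₂
  have hexp : HasDerivAt (fun y => (Real.exp y : ℂ)) (Real.exp x : ℂ) x := (Real.hasDerivAt_exp x).ofReal_comp
  have hdc : (((W x - 1) ^ 2 - S x ^ 2 : ℝ) : ℂ) ≠ 0 := Complex.ofReal_ne_zero.2 hd0
  have hθc := congrArg (fun t : ℝ => (t : ℂ)) hθ
  have hkc := congrArg (fun t : ℝ => (t : ℂ)) hk
  have hAc := congrArg (fun t : ℝ => (t : ℂ)) hA
  have hBc := congrArg (fun t : ℝ => (t : ℂ)) hB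
  have hCc := congrArg (fun t : ℝ => (t : ℂ)) hC
  have hDc := congrArg (fun t : ℝ => (t : ℂ)) hD
  push_cast at hθc hkc hAc hBc hCc hDc hdc e₁ e₂
  constructor
  · have hraw := hexp.mul hŵ.hasDerivAt
    refine hraw.congr_deriv ?_
    apply mul_left_cancel₀ hdc
    linear_combination (Real.exp x : ℂ) * e₁ - (Λ * (Real.exp x * ŵ x)) * hθc
      - (Real.exp x * ŵ x) * hAc - (Real.exp x * ŝ x) * hBc - (3 * Λ * (Real.exp x * ŝ x)) * hkc
  · have hraw := hexp.mul hŝ.hasDerivAt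
    refine hraw.congr_deriv ?_
    apply mul_left_cancel₀ hdc
    linear_combination (Real.exp x : ℂ) * e₂ - (Λ * (Real.exp x * ŝ x)) * hθc
      - (Real.exp x * ŝ x) * hDc - (Real.exp x * ŵ x) * hCc - (Λ / 3 * (Real.exp x * ŵ x)) * hkc

/-- **THE SYMMETRIC PAIR SYSTEM OF THE TRAVELLING-WAVE AMPLITUDES.** If `𝒰′ = (Θ − 2 + A)𝒰 + (3Λk + B)𝒮`,
`𝒮′ = (Θ + D)𝒮 + (Λk/3 + C)𝒰` at `x` for a differentiable real `k` with `k(x) ≠ 0`, then `v = 𝒮 + (Λk/3)𝒰` and `z = Λk𝒮`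
satisfy `v′ = Θv + κz + E_v`, `z′ = Θz + κv + E_z` with `κ = Λk(x)` and the remainders
`E_v = (k′/k − 1 + A)(v − 𝒮) + (D + κB/3)𝒮 + C𝒰`, `E_z = (k′/k − 1 + D)z + κC𝒰` (note `(κ/3)𝒰 = v − 𝒮`). [folklore] -/
theorem inner_vz_hasDerivAt {Uf Sf : ℝ → ℂ} {kf : ℝ → ℝ} {Λ Θ : ℂ} {A Bc Cc Dc kr' : ℝ} {x : ℝ}
    (hU : HasDerivAt Uf ((Θ - 2 + A) * Uf x + (3 * (Λ * kf x) + Bc) * Sf x) x)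
    (hS : HasDerivAt Sf ((Θ + Dc) * Sf x + (Λ * kf x / 3 + Cc) * Uf x) x)
    (hk : HasDerivAt kf kr' x) (hk0 : kf x ≠ 0) :
    HasDerivAt (fun y => Sf y + (Λ * kf y / 3) * Uf y)
      (Θ * (Sf x + (Λ * kf x / 3) * Uf x) + (Λ * kf x) * (Λ * kf x * Sf x) +
        (((kr' / kf x - 1 + A : ℝ) : ℂ) * ((Sf x + (Λ * kf x / 3) * Uf x) - Sf x) +
          (Dc + Λ * kf x * Bc / 3) * Sf x + Cc * Uf x)) x ∧
    HasDerivAt (fun y => Λ * kf y * Sf y)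
      (Θ * (Λ * kf x * Sf x) + (Λ * kf x) * (Sf x + (Λ * kf x / 3) * Uf x) +
        (((kr' / kf x - 1 + Dc : ℝ) : ℂ) * (Λ * kf x * Sf x) + Λ * kf x * Cc * Uf x)) x := by
  have hkc : HasDerivAt (fun y => (kf y : ℂ)) (kr' : ℂ) x := hk.ofReal_comp
  have hk0c : (kf x : ℂ) ≠ 0 := Complex.ofReal_ne_zero.2 hk0
  have h3 : HasDerivAt (fun y => Λ * (kf y : ℂ) / 3) (Λ * kr' / 3) x := by
    simpa using (hkc.const_mul Λ).div_const 3
  have h4 : HasDerivAt (fun y => Λ * (kf y : ℂ)) (Λ * kr') x := hkc.const_mul Λ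
  constructor
  · have hraw := hS.add (h3.mul hU)
    refine hraw.congr_deriv ?_
    push_cast
    field_simp
    ring
  · have hraw := h4.mul hS
    refine hraw.congr_deriv ?_
    push_cast
    field_simp
    ring

end Summit.AtomisticToContinuum.HydrodynamicLimit.Theorems.SonicCavityRenewal

end
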